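import Summits.ABC.IUTFork.Cor312SettingPrFramesM
import Summits.ABC.IUTFork.Cor312SettingMSharp
import HarnessLib

/-!
# [IUTchIII] Corollary 3.12, statement — ROBUSTNESS of the M-level SHARP setting: abc-iut-w5-d166's frames-route
# `settingMSharp` IS the field-box twin `settingPrFramesM` at the sharp binders, hence carries the same numbers, the same
# typed Statement and the same provenance as the summand-route setting `settingPrVolM` at those binders

PROOF-ONLY record file (D-0012; no definitions) of the abc-iut cell (seat abc-iut-w4-d013, gen 6; branch C «abc ⇐ S», C-lead
ruling C-R12 (e) «target #2′»; the two-routes half of the bridge `Cor312SettingMSharpRobust` announced by the G1-Θ lead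
abc-iut-w5-d166, 09:52:59Z — the half that needs only the lead's setting, written on this seat's `Cor312SettingPrFramesM`
(p436551); the identification with abc-iut-s2-p8's summand-route sharp setting `settingPrVolSharpM` (unit P4) is the other
half, one `rfl`/`ext` on the box binders away once P4 lands). TAKES NO SIDE on [IUTchIII] Cor. 3.12.

abc-iut-w5-d166's `Real.settingMSharp` (`Cor312SettingMSharp`, p435453) is abc-iut-c312-6's `settingOfFrameVolumes` over the
M-level field-box pieces `frameVolumePiecesOfInitialDH` with the SHARP Dupuy–Hilado Θ-boxes `thetaBoxM t` and the `q`-centre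
`qCentreM tq` read off idele binders `t`, `tq` in the genuine completions `K_{v̲}` ([IUTchI] Def. 3.1 (e), kurims
`paper:url-690e7b3c6199` p. 62; Dupuy–Hilado §3.9/§4.10). This seat's `Real.settingPrFramesM` (`Cor312SettingPrFramesM`) is the
SAME construction for GENERIC Θ-box / `q`-centre binders, proved there to carry the same `qLocal`/`thetaLocal`/`negLogTheta`/
`negLogQ`/`Statement`/`IsSettingOf` as the SUMMAND-route setting `Real.settingPrVolM` (`Cor312SettingPrVolM`, p435693; the route
of abc-iut-c312-7's `settingPrVolSharp` named by branch C's READ binder `hΘ`). THIS FILE instantiates: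

* `qSupport_finite_PrVolM_sharp` — the summand-route `hfin` at the sharp `q`-centre (the lead's `qSupport_finite_M` transported
  along `qSupport_framesPrM_eq`);
* **`settingMSharp_eq_settingPrFramesM`** — `settingMSharp … t tq htq0 Sq htq1 = settingPrFramesM … (thetaBoxM t) (qCentreM tq) …`
  (`rfl`: same situation, same pieces, same binders; the two `hfin` proofs agree by proof irrelevance);
* `settingPrVolMSharpOf` is NOT defined here (the summand-route sharp setting is unit P4, abc-iut-s2-p8): every statement
  below is about `settingPrVolM` AT the lead's sharp binders `(fun _ _ => thetaBoxM D hlog t) (fun _ => qCentreM D hlog tq)`;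
* **`thetaLocal_settingMSharp_eq`**, **`negLogTheta_settingMSharp_eq`**, `negLogQ_settingMSharp_eq`, `qLocal_settingMSharp_eq`,
  **`statement_settingMSharp_iff`**, **`isSettingOf_settingMSharp_iff`** — ROBUSTNESS: the frames-route sharp setting and the
  summand-route setting at the same sharp binders have the same local and global Θ- and `q`-numbers, the same typed Cor. 3.12
  Statement (p. 174 l. 16–18) and the same abc-iut-c312-8 provenance `IsSettingOf D`; so units P5/P6 proved on EITHER route
  transfer (abc-iut-c312-6's hull-set locality, via p436551).
[claim: Mochizuki2012, status: disputed] for the quoted setting; [cite: Mochizuki2012, IUTchI Def. 3.1 (e) p. 62];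
[cite: DupuyHilado2025, §3.9, §4.10]. HONEST FRAMING: bookkeeping (`rfl` + instantiation); no edit to the lead's or anyone's
files; nothing here bears on the truth of [IUTchIII] Cor. 3.12; typed ≠ proved; instantiated ≠ endorsed.
-/

noncomputable section

open Set Function NumberField IsDedekindDomain

namespace Summit.ABC.IUTFork.Thm311.Real

open Cor312 Cor312Vol Cor312Prov Literature.IUT.LogThetaLattice Literature.IUT.LogVolume Literature.IUT.HodgeTheaters
  Literature.NumberTheory.NumberFields

variable {F K Fbar : Type} [Field F] [NumberField F] [Field K] [NumberField K] [Algebra F K]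
  [Field Fbar] [Algebra F Fbar] [Algebra K Fbar] {E : WeierstrassCurve F} [E.IsElliptic] {l : ℕ}
  {Pb : BadPlacePredicates K} (D : InitialThetaData F K Fbar E l Pb) {logvK : PadicLogsVal K}
  (hlog : LogvAnalyticVal logvK)
  (M : Type) [Field M] [NumberField M]
  (archPk : ∀ (j : (thetaIndexOfInitial D).Label) (vQ : (thetaIndexOfInitial D).VQ),
    Set ((logShellsOfInitialDH D logvK).Packet j vQ))
  (archSub : ∀ (j : (thetaIndexOfInitial D).Label) (v : (thetaIndexOfInitial D).V),
    Set ((logShellsOfInitialDH D logvK).Packet j ((thetaIndexOfInitial D).over v)))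
  (Ψ : ℤ → ∀ v : (thetaIndexOfInitial D).V, v ∈ (thetaIndexOfInitial D).Vbad →
    Set ((logShellsOfInitialDH D logvK).StarPacket v))
  (act : ℤ → ∀ v : (thetaIndexOfInitial D).V, v ∈ (thetaIndexOfInitial D).Vbad →
    (logShellsOfInitialDH D logvK).StarPacket v → Module.End ℚ ((logShellsOfInitialDH D logvK).StarPacket v))
  (Mmod : ℤ → ∀ j : (thetaIndexOfInitial D).LabelStar, Set ((logShellsOfInitialDH D logvK).GlobalPacket j.1))
  (region : ℤ → ∀ j : (thetaIndexOfInitial D).LabelStar, FinDivisor M → ∀ vQ : (thetaIndexOfInitial D).VQ,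
    Set ((logShellsOfInitialDH D logvK).Packet j.1 vQ))
  (n : ℤ) {HT : Type} {LogLink : HT → HT → Type} {IsFull : ∀ {s t : HT}, LogLink s t → Prop}
  (lat : LGPGaussianLogThetaLattice LogLink IsFull)
  {Frd : Type} {IsoF : Frd → Frd → Type} {Ob : Frd → Type} {realify : Frd → Frd} {Strip : Type}
  {IsoS : Strip → Strip → Type}
  {Mv : ∀ v : (thetaIndexOfInitial D).V, v ∈ (thetaIndexOfInitial D).Vbad → Type} [∀ v h, Monoid (Mv v h)]
  (sig : GlobalLGPFrobenioidSignature (thetaIndexOfInitial D).lstar (thetaIndexOfInitial D).V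
    (· ∈ (thetaIndexOfInitial D).Vbad) Frd IsoF Ob realify Strip IsoS Mv)
  (split : SplittingMonoids Mv) {ObΔ : Type}
  {N : ∀ v : (thetaIndexOfInitial D).V, v ∈ (thetaIndexOfInitial D).Vbad → Type} [∀ v h, Monoid (N v h)]
  (qData : QPilotData ObΔ N)
  (t : ∀ (u : FinitePlace ℚ) (_ : Fin (thetaIndexOfInitial D).lstar) (x : (thetaIndexOfInitial D).Fibre (Val.non u)),
    kOfM D (ratChar u) u (natCast_ratChar_mem u) x)
  (tq : ∀ (u : FinitePlace ℚ) (x : (thetaIndexOfInitial D).Fibre (Val.non u)),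
    kOfM D (ratChar u) u (natCast_ratChar_mem u) x)
  (htq0 : ∀ u x, tq u x ≠ 0) (Sq : Finset (FinitePlace ℚ))
  (htq1 : ∀ (u : FinitePlace ℚ) (x : (thetaIndexOfInitial D).Fibre (Val.non u)), u ∉ Sq → ‖tq u x‖ = 1)

include htq0 Sq htq1 in
/-- **The summand-route `hfin` at the sharp `q`-centre**: off `Sq` the `q`-ideles are units, so the summand-route local
`q`-volume vanishes there — abc-iut-w5-d166's `qSupport_finite_M` (frames route, [IUTchIII] Prop. 3.9 (iii)) transported
along `qSupport_framesPrM_eq`. [cite: Mochizuki2012, IUTchIII Prop. 3.9 (iii) p. 117] -/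
theorem qSupport_finite_PrVolM_sharp (j : (thetaIndexOfInitial D).Label) :
    (Function.support fun vQ => ((situationPrVolM D hlog M archPk archSub Ψ act Mmod region).D n).logvol j vQ
      (factorMapM D hlog j vQ ⁻¹' hullSet (factorFieldM D hlog j vQ)
        ((fun _ : ObΔ => qCentreM D hlog tq) (qPilotObject qData) j vQ))).Finite := by
  rw [← qSupport_framesPrM_eq D hlog M archPk archSub Ψ act Mmod region n qData (fun _ => qCentreM D hlog tq)
    (fun j vQ s => qCentreM_ne_zero D hlog tq htq0 j vQ s) j]
  exact qSupport_finite_M D hlog M archPk archSub Ψ act Mmod region n qData tq Sq htq1 j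

/-- **The lead's frames-route sharp setting IS the field-box twin at the sharp binders** (definitional: same situation
`Situation.ofShells … V.Adm V.logvol …`, same pieces, same Θ-boxes / `q`-centre / `hq`; the two `hfin` proofs agree by proof
irrelevance). [folklore] -/
theorem settingMSharp_eq_settingPrFramesM :
    settingMSharp D hlog M archPk archSub Ψ act Mmod region n lat sig split qData t tq htq0 Sq htq1 =
      settingPrFramesM D hlog M archPk archSub Ψ act Mmod region n lat sig split qData (fun _ _ => thetaBoxM D hlog t)
        (fun _ => qCentreM D hlog tq) (fun j vQ s => qCentreM_ne_zero D hlog tq htq0 j vQ s)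
        (qSupport_finite_PrVolM_sharp D hlog M archPk archSub Ψ act Mmod region n qData tq htq0 Sq htq1) :=
  rfl

/-- **Same local `q`-volume** on the two routes at the sharp binders. [claim: Mochizuki2012, status: disputed] -/
theorem qLocal_settingMSharp_eq (j : (thetaIndexOfInitial D).Label) (vQ : (thetaIndexOfInitial D).VQ) :
    (settingMSharp D hlog M archPk archSub Ψ act Mmod region n lat sig split qData t tq htq0 Sq htq1).qLocal j vQ =
      (settingPrVolM D hlog M archPk archSub Ψ act Mmod region n lat sig split qData (fun _ _ => thetaBoxM D hlog t)
        (fun _ => qCentreM D hlog tq) (fun j vQ s => qCentreM_ne_zero D hlog tq htq0 j vQ s)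
        (qSupport_finite_PrVolM_sharp D hlog M archPk archSub Ψ act Mmod region n qData tq htq0 Sq htq1)).qLocal j vQ := by
  rw [settingMSharp_eq_settingPrFramesM]
  exact qLocal_settingPrFramesM D hlog M archPk archSub Ψ act Mmod region n lat sig split qData _ _ _ _ j vQ

/-- **Same local `−|log(Θ)|`** on the two routes at the sharp binders. [claim: Mochizuki2012, status: disputed] -/
theorem thetaLocal_settingMSharp_eq (j : (thetaIndexOfInitial D).Label) (vQ : (thetaIndexOfInitial D).VQ) :
    (settingMSharp D hlog M archPk archSub Ψ act Mmod region n lat sig split qData t tq htq0 Sq htq1).thetaLocal j vQ =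
      (settingPrVolM D hlog M archPk archSub Ψ act Mmod region n lat sig split qData (fun _ _ => thetaBoxM D hlog t)
        (fun _ => qCentreM D hlog tq) (fun j vQ s => qCentreM_ne_zero D hlog tq htq0 j vQ s)
        (qSupport_finite_PrVolM_sharp D hlog M archPk archSub Ψ act Mmod region n qData tq htq0 Sq htq1)).thetaLocal
        j vQ := by
  rw [settingMSharp_eq_settingPrFramesM]
  exact thetaLocal_settingPrFramesM D hlog M archPk archSub Ψ act Mmod region n lat sig split qData _ _ _ _ j vQ

/-- **Same `−|log(Θ)|`** on the two routes at the sharp binders — so a Θ-side bound (unit P6) proved on either route is a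
bound on the other. [claim: Mochizuki2012, status: disputed] -/
theorem negLogTheta_settingMSharp_eq :
    (settingMSharp D hlog M archPk archSub Ψ act Mmod region n lat sig split qData t tq htq0 Sq htq1).negLogTheta =
      (settingPrVolM D hlog M archPk archSub Ψ act Mmod region n lat sig split qData (fun _ _ => thetaBoxM D hlog t)
        (fun _ => qCentreM D hlog tq) (fun j vQ s => qCentreM_ne_zero D hlog tq htq0 j vQ s)
        (qSupport_finite_PrVolM_sharp D hlog M archPk archSub Ψ act Mmod region n qData tq htq0 Sq htq1)).negLogTheta := by
  rw [settingMSharp_eq_settingPrFramesM]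
  exact negLogTheta_settingPrFramesM D hlog M archPk archSub Ψ act Mmod region n lat sig split qData _ _ _ _

/-- **Same `−|log(q)|`** on the two routes at the sharp binders. [claim: Mochizuki2012, status: disputed] -/
theorem negLogQ_settingMSharp_eq :
    (settingMSharp D hlog M archPk archSub Ψ act Mmod region n lat sig split qData t tq htq0 Sq htq1).negLogQ =
      (settingPrVolM D hlog M archPk archSub Ψ act Mmod region n lat sig split qData (fun _ _ => thetaBoxM D hlog t)
        (fun _ => qCentreM D hlog tq) (fun j vQ s => qCentreM_ne_zero D hlog tq htq0 j vQ s)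
        (qSupport_finite_PrVolM_sharp D hlog M archPk archSub Ψ act Mmod region n qData tq htq0 Sq htq1)).negLogQ := by
  rw [settingMSharp_eq_settingPrFramesM]
  exact negLogQ_settingPrFramesM D hlog M archPk archSub Ψ act Mmod region n lat sig split qData _ _ _ _

/-- **`ThetaFinite` transfers** between the two routes at the sharp binders (it reads `thetaLocal` only) — unit P5 proved
on either route serves both. [claim: Mochizuki2012, status: disputed] -/
theorem thetaFinite_settingMSharp_iff :
    (settingMSharp D hlog M archPk archSub Ψ act Mmod region n lat sig split qData t tq htq0 Sq htq1).ThetaFinite ↔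
      (settingPrVolM D hlog M archPk archSub Ψ act Mmod region n lat sig split qData (fun _ _ => thetaBoxM D hlog t)
        (fun _ => qCentreM D hlog tq) (fun j vQ s => qCentreM_ne_zero D hlog tq htq0 j vQ s)
        (qSupport_finite_PrVolM_sharp D hlog M archPk archSub Ψ act Mmod region n qData tq htq0 Sq htq1)).ThetaFinite := by
  unfold Setting.ThetaFinite
  simp only [thetaLocal_settingMSharp_eq]

/-- **ROBUSTNESS OF THE TYPED STATEMENT AT THE M-LEVEL SHARP SETTING**: the typed [IUTchIII] Cor. 3.12
(`Cor312.Setting.Statement`, p. 174 l. 16–18) at the lead's frames-route sharp setting ↔ at the summand-route setting with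
the same sharp binders. Neither side asserted. [claim: Mochizuki2012, status: disputed] -/
theorem statement_settingMSharp_iff :
    (settingMSharp D hlog M archPk archSub Ψ act Mmod region n lat sig split qData t tq htq0 Sq htq1).Statement ↔
      (settingPrVolM D hlog M archPk archSub Ψ act Mmod region n lat sig split qData (fun _ _ => thetaBoxM D hlog t)
        (fun _ => qCentreM D hlog tq) (fun j vQ s => qCentreM_ne_zero D hlog tq htq0 j vQ s)
        (qSupport_finite_PrVolM_sharp D hlog M archPk archSub Ψ act Mmod region n qData tq htq0 Sq htq1)).Statement := by
  rw [settingMSharp_eq_settingPrFramesM]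
  exact statement_settingPrFramesM_iff D hlog M archPk archSub Ψ act Mmod region n lat sig split qData _ _ _ _

/-- **abc-iut-c312-8's provenance `IsSettingOf D` transfers** between the two routes at the sharp binders.
[claim: Mochizuki2012, status: disputed] -/
theorem isSettingOf_settingMSharp_iff :
    IsSettingOf D (settingMSharp D hlog M archPk archSub Ψ act Mmod region n lat sig split qData t tq htq0 Sq htq1) ↔
      IsSettingOf D (settingPrVolM D hlog M archPk archSub Ψ act Mmod region n lat sig split qData
        (fun _ _ => thetaBoxM D hlog t) (fun _ => qCentreM D hlog tq) (fun j vQ s => qCentreM_ne_zero D hlog tq htq0 j vQ s)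
        (qSupport_finite_PrVolM_sharp D hlog M archPk archSub Ψ act Mmod region n qData tq htq0 Sq htq1)) := by
  rw [settingMSharp_eq_settingPrFramesM]
  exact isSettingOf_settingPrFramesM_iff D hlog M archPk archSub Ψ act Mmod region n lat sig split qData _ _ _ _

/-- Hence the provenance-form conjunction `IsSettingOf D P ∧ P.Statement` (the sentence of record of plan ADJUDICATION-SPEC §1)
transfers between the two routes at the sharp binders. [claim: Mochizuki2012, status: disputed] -/
theorem isSettingOf_and_statement_settingMSharp_iff :
    (IsSettingOf D (settingMSharp D hlog M archPk archSub Ψ act Mmod region n lat sig split qData t tq htq0 Sq htq1) ∧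
      (settingMSharp D hlog M archPk archSub Ψ act Mmod region n lat sig split qData t tq htq0 Sq htq1).Statement) ↔
    (IsSettingOf D (settingPrVolM D hlog M archPk archSub Ψ act Mmod region n lat sig split qData
        (fun _ _ => thetaBoxM D hlog t) (fun _ => qCentreM D hlog tq) (fun j vQ s => qCentreM_ne_zero D hlog tq htq0 j vQ s)
        (qSupport_finite_PrVolM_sharp D hlog M archPk archSub Ψ act Mmod region n qData tq htq0 Sq htq1)) ∧
      (settingPrVolM D hlog M archPk archSub Ψ act Mmod region n lat sig split qData (fun _ _ => thetaBoxM D hlog t)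
        (fun _ => qCentreM D hlog tq) (fun j vQ s => qCentreM_ne_zero D hlog tq htq0 j vQ s)
        (qSupport_finite_PrVolM_sharp D hlog M archPk archSub Ψ act Mmod region n qData tq htq0 Sq htq1)).Statement) :=
  and_congr (isSettingOf_settingMSharp_iff D hlog M archPk archSub Ψ act Mmod region n lat sig split qData t tq htq0 Sq htq1)
    (statement_settingMSharp_iff D hlog M archPk archSub Ψ act Mmod region n lat sig split qData t tq htq0 Sq htq1)

end Summit.ABC.IUTFork.Thm311.Real

end
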